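import Summits.ABC.ABC.Theorems.TwistAmplificationSharpModerateLawCoreDefs
import Summits.ABC.ABC.Theorems.TwistAmplificationSharpModerateLawCuspTransferCone
import Summits.ABC.ABC.Theorems.TwistAmplificationModerateWindowCountCalibration

/-!
# Crux `TwistAmplification.SharpModerateLaw` (stmt-ABC-1975): the canonical core transfer
`CoreLaw → SharpModerateLaw`

Worker of lead `prover-line-stmt-ABC-1975-c4-0` (line `unit-plane-conic-two-torsion`, wave 2 of the open stub
`stub_cornerHall`, which stays OPEN), 2026-08-16.

The lead's Szpiro-robust canonical core `CoreLaw` (`…CoreDefs.lean`: for all `3 < κ₀ < σ` and `ε > 0`,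
`#cuspShell(X, Y) ≤ C·(XY)^ε·(X·Y^{-1/6} + 1)` on `X^{κ₀} ≤ Y ≤ X^σ`) implies the crux:
**`sharpModerateLaw_of_coreLaw : CoreLaw → SharpModerateLaw`** (registered sub-goal of stmt-ABC-1975), hence the
summit (`abc_of_coreLaw`, through the landed `abc_of_sharpModerateLaw`).

Proof: the landed transfer `cuspTransferCone` (`…CuspTransferCone.lean`) verbatim, except where the law is invoked.
Given `3 < κ < 6 < σ` put `κ₀ := (3+κ)/2 ∈ (3, κ)` and use `CoreLaw` at `(κ₀, σ, ε/(2(σ+1)))`. At the shell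
`(X_j, 2^j)`, `X_j = min(X, 2^{(j+1)/κ})`, one has `X_j^{κ₀} ≤ 2^{(j+1)κ₀/κ} ≤ 2^j` as soon as `j(κ − κ₀) ≥ κ₀`, i.e. for
`j ≥ j₀ := ⌈κ₀/(κ − κ₀)⌉`, and `2^j ≤ X_j^σ` always; so for `j ≥ j₀` the landed per-shell bound
`3·C₀·X^{ε/2}·X^{1−κ/6}` goes through.  The finitely many shells `j < j₀` lie in the finite box
`{1728 ∣ c₄³ − c₆², M⁺ < 2·2^{j₀}}` (`box_finite`), whose size `K = K(κ)` is folded into the constant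
(`X^{ε/2}·X^{1−κ/6} ≥ 1`): every shell is `≤ (K + 3C₀)·X^{ε/2}·X^{1−κ/6}`, and the assembly over the
`J + 1 ≤ (2σ/(ε log 2) + 1)·X^{ε/2}` shells and the `12` reduced triples is the landed one.
-/

noncomputable section

-- the mandated summit namespace `Summit.ABC.ABC` (summit = problem) trips the duplicate-namespace linter
set_option linter.dupNamespace false

namespace Summit.ABC.ABC.Theorems.SharpModerateLaw

open WeierstrassCurve IsDedekindDomain Rat.HeightOneSpectrum Real

/-! ## 1. The finite level boxes -/

/-- The level box `{1728 ∣ c₄³ − c₆², M⁺ < M}` is finite (`|c₄|³ ≤ M⁺ < M` and `c₆² ≤ |c₄|³ + 1728·M⁺`; the argument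
of the landed `cuspShell_finite`, which uses only these two membership conditions). -/
theorem box_finite (M : ℝ) : {x : ℤ × ℤ | (1728 : ℤ) ∣ x.1 ^ 3 - x.2 ^ 2 ∧ (Mcusp x : ℝ) < M}.Finite := by
  -- adapted from `cuspShell_finite` (…CuspCoordinates.lean)
  set Y' : ℝ := max M 1 with hY'
  have hY'1 : (1 : ℝ) ≤ Y' := le_max_right _ _
  have hMY' : M ≤ Y' := le_max_left _ _
  have hT : (1 : ℝ) ≤ 3458 * Y' := by linarith
  set N : ℕ := Nat.ceil (3458 * Y') with hN
  have hTN : 3458 * Y' ≤ N := Nat.le_ceil _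
  refine (Set.Finite.prod (Set.finite_Icc (-(N : ℤ)) N) (Set.finite_Icc (-(N : ℤ)) N)).subset ?_
  rintro ⟨x, y⟩ ⟨hdvd, hM⟩
  simp only [Set.mem_prod, Set.mem_Icc]
  have hM' : ((Mcusp (x, y) : ℕ) : ℝ) < 2 * Y' := hM.trans_le (by linarith)
  have hx3 : ((x.natAbs ^ 3 : ℕ) : ℝ) < 2 * Y' :=
    lt_of_le_of_lt (by exact_mod_cast le_max_right _ _) hM'
  have hq : ((((x ^ 3 - y ^ 2) / 1728).natAbs : ℕ) : ℝ) < 2 * Y' :=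
    lt_of_le_of_lt (by exact_mod_cast le_max_left _ _) hM'
  obtain ⟨k, hk⟩ := hdvd
  have hk' : (x ^ 3 - y ^ 2) / 1728 = k := by rw [hk]; simp
  rw [hk'] at hq
  have hxR : |(x : ℝ)| ^ 3 < 2 * Y' := by
    have : ((x.natAbs ^ 3 : ℕ) : ℝ) = |(x : ℝ)| ^ 3 := by push_cast; rw [Nat.cast_natAbs, Int.cast_abs]
    rwa [this] at hx3
  have hkR : |(k : ℝ)| < 2 * Y' := by
    have : ((k.natAbs : ℕ) : ℝ) = |(k : ℝ)| := by rw [Nat.cast_natAbs, Int.cast_abs]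
    rwa [this] at hq
  have hxy : (x : ℝ) ^ 3 - (y : ℝ) ^ 2 = 1728 * k := by exact_mod_cast hk
  -- `|x|³ ≤ T`, `T ≥ 1` ⇒ `|x| ≤ T`; `y² ≤ T`, `T ≥ 1` ⇒ `|y| ≤ T`
  have cube_le : ∀ {z : ℝ}, |z| ^ 3 ≤ 3458 * Y' → |z| ≤ 3458 * Y' := by
    intro z h
    rcases le_or_gt |z| 1 with h1 | h1
    · exact h1.trans hT
    · have h2 : 0 ≤ |z| * (|z| ^ 2 - 1) := mul_nonneg (abs_nonneg _) (by nlinarith)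
      nlinarith [h2]
  have sq_le : ∀ {z : ℝ}, z ^ 2 ≤ 3458 * Y' → |z| ≤ 3458 * Y' := by
    intro z h
    rcases le_or_gt |z| 1 with h1 | h1
    · exact h1.trans hT
    · have h2 : 0 ≤ |z| * (|z| - 1) := mul_nonneg (abs_nonneg _) (by linarith)
      have h3 : |z| ^ 2 = z ^ 2 := sq_abs z
      nlinarith [h2, h3]
  have hx' : |(x : ℝ)| ≤ N := (cube_le (by linarith)).trans hTN
  have hy2 : (y : ℝ) ^ 2 ≤ 3458 * Y' := by
    have h2 : (x : ℝ) ^ 3 ≤ |(x : ℝ)| ^ 3 := by rw [← abs_pow]; exact le_abs_self _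
    have h5 := (abs_lt.mp hkR).1
    nlinarith
  have hy' : |(y : ℝ)| ≤ N := (sq_le hy2).trans hTN
  have hx'' : |x| ≤ (N : ℤ) := by exact_mod_cast hx'
  have hy'' : |y| ≤ (N : ℤ) := by exact_mod_cast hy'
  exact ⟨⟨(abs_le.mp hx'').1, (abs_le.mp hx'').2⟩, ⟨(abs_le.mp hy'').1, (abs_le.mp hy'').2⟩⟩

/-- A cusp shell of level `Y` lies in every level box `M⁺ < M` with `2Y ≤ M`. -/
theorem cuspShell_subset_box {X Y M : ℝ} (h : 2 * Y ≤ M) :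
    cuspShell X Y ⊆ {x : ℤ × ℤ | (1728 : ℤ) ∣ x.1 ^ 3 - x.2 ^ 2 ∧ (Mcusp x : ℝ) < M} := by
  rintro x ⟨-, -, -, hdvd, -, -, hM, -⟩
  exact ⟨hdvd, lt_of_lt_of_le hM h⟩

/-- Hence `#cuspShell(X, Y) ≤ #{1728 ∣ c₄³ − c₆², M⁺ < M}` for `2Y ≤ M`, uniformly in `X` (as reals). -/
theorem ncard_cuspShell_le_box {X Y M : ℝ} (h : 2 * Y ≤ M) :
    ((cuspShell X Y).ncard : ℝ) ≤
      (Set.ncard {x : ℤ × ℤ | (1728 : ℤ) ∣ x.1 ^ 3 - x.2 ^ 2 ∧ (Mcusp x : ℝ) < M} : ℝ) := by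
  exact_mod_cast Set.ncard_le_ncard (cuspShell_subset_box h) (box_finite M)

/-! ## 2. The core transfer -/

/-- **`sharpModerateLaw_of_coreLaw`** (registered sub-goal of stmt-ABC-1975): the Szpiro-robust canonical core
`CoreLaw` implies the crux `SharpModerateLaw`.  Constant: `12·(K + 3·max(C,0))·(2σ/(ε log 2) + 1)` with `C` the core
constant at `(κ₀, σ, ε/(2(σ+1)))`, `κ₀ = (3+κ)/2`, and `K = #{1728 ∣ c₄³ − c₆², M⁺ < 2·2^{j₀}}`,
`j₀ = ⌈κ₀/(κ−κ₀)⌉`. -/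
theorem sharpModerateLaw_of_coreLaw : CoreLaw → Summit.ABC.ABC.Theses.TwistAmplification.SharpModerateLaw := by
  -- adapted from `cuspTransferCone` (…CuspTransferCone.lean): only the invocation of the law changes
  intro hlaw κ σ ε hκ3 hκ6 hσ6 hε
  have hκ0 : 0 < κ := by linarith
  have hσ0 : 0 ≤ σ := by linarith
  have hε' : 0 < ε / (2 * (σ + 1)) := by positivity
  -- the robust exponent `κ₀ ∈ (3, κ)` and the threshold shell index `j₀`
  set κ₀ : ℝ := (3 + κ) / 2 with hκ₀
  have hκ₀3 : 3 < κ₀ := by rw [hκ₀]; linarith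
  have hκ₀κ : κ₀ < κ := by rw [hκ₀]; linarith
  have hκ₀σ : κ₀ < σ := by linarith
  obtain ⟨C, hC⟩ := hlaw κ₀ σ hκ₀3 hκ₀σ (ε / (2 * (σ + 1))) hε'
  set C₀ : ℝ := max C 0 with hC₀
  have hC₀0 : 0 ≤ C₀ := le_max_right _ _
  set j₀ : ℕ := ⌈κ₀ / (κ - κ₀)⌉₊ with hj₀
  -- the finite box containing every shell of level `≤ 2^{j₀}`
  set K : ℝ := (Set.ncard {x : ℤ × ℤ | (1728 : ℤ) ∣ x.1 ^ 3 - x.2 ^ 2 ∧ (Mcusp x : ℝ) < 2 * (2 : ℝ) ^ j₀} : ℝ)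
    with hK
  have hK0 : 0 ≤ K := Nat.cast_nonneg _
  refine ⟨12 * (K + 3 * C₀) * (2 * σ / (ε * Real.log 2) + 1), fun X hX => ?_⟩
  have hX0 : 0 < X := by linarith
  -- the shells
  set J : ℕ := Nat.log 2 ⌊X ^ σ⌋₊ with hJ
  set Xj : ℕ → ℝ := fun j => min X ((2 : ℝ) ^ (((j + 1 : ℕ) : ℝ) / κ)) with hXj
  set T : Finset (ℤ × ℤ × ℤ) := ({0, 1} : Finset ℤ) ×ˢ (({-1, 0, 1} : Finset ℤ) ×ˢ ({0, 1} : Finset ℤ))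
    with hT
  set U : Set (ℤ × ℤ) := ⋃ j ∈ Finset.range (J + 1), cuspShell (Xj j) ((2 : ℝ) ^ j) with hU
  have hfin : ((↑T : Set (ℤ × ℤ × ℤ)) ×ˢ U).Finite :=
    T.finite_toSet.prod (Set.Finite.biUnion (Finset.range (J + 1)).finite_toSet
      fun j _ => cuspShell_finite _ _)
  -- Step 1: the window maps injectively into `T × U`
  have hmaps : ∀ W : WeierstrassCurve ℤ, W ∈ {W₀ : WeierstrassCurve ℤ | (W₀.baseChange ℚ).IsElliptic ∧
      (∀ v : IsDedekindDomain.HeightOneSpectrum ℤ, (W₀.baseChange ℚ).IsMinimalAt v) ∧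
      (W₀.a₁ = 0 ∨ W₀.a₁ = 1) ∧ (W₀.a₃ = 0 ∨ W₀.a₃ = 1) ∧ (W₀.a₂ = -1 ∨ W₀.a₂ = 0 ∨ W₀.a₂ = 1) ∧
      W₀.c₄ ≠ 0 ∧ W₀.c₆ ≠ 0 ∧ (((W₀.baseChange ℚ).conductorNorm ℤ : ℕ) : ℝ) ≤ X ∧
      (((W₀.baseChange ℚ).conductorNorm ℤ : ℕ) : ℝ) ^ κ ≤ ((max |W₀.Δ| (|W₀.c₄| ^ 3) : ℤ) : ℝ) ∧
      ((max |W₀.Δ| (|W₀.c₄| ^ 3) : ℤ) : ℝ) ≤ (((W₀.baseChange ℚ).conductorNorm ℤ : ℕ) : ℝ) ^ σ} →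
      ((W.a₁, W.a₂, W.a₃), (W.c₄, W.c₆)) ∈ (↑T : Set (ℤ × ℤ × ℤ)) ×ˢ U := by
    intro W hW
    obtain ⟨hE, hmin, h₁, h₃, h₂, hc₄, hc₆, hNX, hlo, hhi⟩ := hW
    refine Set.mk_mem_prod ?_ ?_
    · simp only [hT, Finset.coe_product, Finset.coe_insert, Finset.coe_singleton, Set.mem_prod,
        Set.mem_insert_iff, Set.mem_singleton_iff]
      exact ⟨h₁, h₂, h₃⟩
    · have hmem := mem_cuspShell_of_window hκ0 hmin hc₄ hc₆ hNX hlo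
      have hjJ := log_Mcusp_le hσ0 hNX hhi
      rw [hU]
      simp only [Set.mem_iUnion, Finset.mem_range]
      exact ⟨Nat.log 2 (Mcusp (W.c₄, W.c₆)), Nat.lt_succ_of_le hjJ, hmem⟩
  have h1 := Set.ncard_le_ncard_of_injOn (fun W : WeierstrassCurve ℤ => ((W.a₁, W.a₂, W.a₃), (W.c₄, W.c₆)))
    hmaps (model_injective.injOn) hfin
  have h2 : ((↑T : Set (ℤ × ℤ × ℤ)) ×ˢ U).ncard = 12 * U.ncard := by
    rw [Set.ncard_prod, Set.ncard_coe_finset, card_reducedTriples]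
  have h3 : U.ncard ≤ ∑ j ∈ Finset.range (J + 1), (cuspShell (Xj j) ((2 : ℝ) ^ j)).ncard :=
    Finset.set_ncard_biUnion_le _ _
  -- Step 2: the per-shell bound
  have hXpow1 : 1 ≤ X ^ (1 - κ / 6) := Real.one_le_rpow hX (by linarith)
  have hXe1 : 1 ≤ X ^ (ε / 2) := Real.one_le_rpow hX (by positivity)
  have hP1 : 1 ≤ X ^ (ε / 2) * X ^ (1 - κ / 6) := one_le_mul_of_one_le_of_one_le hXe1 hXpow1
  have hshell : ∀ j ∈ Finset.range (J + 1),
      ((cuspShell (Xj j) ((2 : ℝ) ^ j)).ncard : ℝ) ≤ (K + 3 * C₀) * X ^ (ε / 2) * X ^ (1 - κ / 6) := by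
    intro j hj
    rcases lt_or_ge j j₀ with hjlt | hjge
    · -- the finitely many small shells `j < j₀` lie in the box
      have h2j : 2 * (2 : ℝ) ^ j ≤ 2 * (2 : ℝ) ^ j₀ := by
        have : (2 : ℝ) ^ j ≤ (2 : ℝ) ^ j₀ := pow_le_pow_right₀ (by norm_num) hjlt.le
        linarith
      calc ((cuspShell (Xj j) ((2 : ℝ) ^ j)).ncard : ℝ) ≤ K := ncard_cuspShell_le_box h2j
        _ ≤ K * (X ^ (ε / 2) * X ^ (1 - κ / 6)) := le_mul_of_one_le_right hK0 hP1
        _ ≤ (K + 3 * C₀) * (X ^ (ε / 2) * X ^ (1 - κ / 6)) := by gcongr; linarith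
        _ = (K + 3 * C₀) * X ^ (ε / 2) * X ^ (1 - κ / 6) := by ring
    -- the shells `j ≥ j₀`: the core law applies (verbatim the landed argument, with `X_j^{κ₀} ≤ 2^j`)
    have hjJ : j ≤ J := Nat.lt_succ_iff.mp (Finset.mem_range.mp hj)
    have hXj1 : 1 ≤ Xj j := le_min hX (Real.one_le_rpow (by norm_num) (by positivity))
    have hXjX : Xj j ≤ X := min_le_left _ _
    have hXj0 : 0 ≤ Xj j := by linarith
    have h2j1 : (1 : ℝ) ≤ (2 : ℝ) ^ j := one_le_pow₀ (by norm_num)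
    have h2jσ : (2 : ℝ) ^ j ≤ X ^ σ := by
      have hfl0 : ⌊X ^ σ⌋₊ ≠ 0 := by
        have : 1 ≤ ⌊X ^ σ⌋₊ := Nat.le_floor (by exact_mod_cast Real.one_le_rpow hX hσ0)
        omega
      have hA : ((2 ^ J : ℕ) : ℝ) ≤ (⌊X ^ σ⌋₊ : ℝ) := by exact_mod_cast Nat.pow_log_le_self 2 hfl0
      push_cast at hA
      calc (2 : ℝ) ^ j ≤ (2 : ℝ) ^ J := pow_le_pow_right₀ (by norm_num) hjJ
        _ ≤ ⌊X ^ σ⌋₊ := hA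
        _ ≤ X ^ σ := Nat.floor_le (by positivity)
    -- the two region conditions at `(X_j, 2^j)`
    set A : ℝ := (2 : ℝ) ^ (((j + 1 : ℕ) : ℝ) / κ) with hA
    have hA1 : 1 ≤ A := Real.one_le_rpow (by norm_num) (by positivity)
    have hAκ : A ^ κ = 2 * (2 : ℝ) ^ j := by
      rw [hA, ← Real.rpow_mul (by norm_num), div_mul_cancel₀ _ hκ0.ne', Real.rpow_natCast, pow_succ, mul_comm]
    have hXjA : Xj j ≤ A := min_le_right _ _
    have hjr : κ₀ / (κ - κ₀) ≤ (j : ℝ) := (Nat.le_ceil _).trans (by exact_mod_cast hjge)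
    have hexp : ((j + 1 : ℕ) : ℝ) / κ * κ₀ ≤ ((j : ℕ) : ℝ) := by
      have hkk : 0 < κ - κ₀ := by linarith
      rw [div_le_iff₀ hkk] at hjr
      rw [div_mul_eq_mul_div, div_le_iff₀ hκ0]
      push_cast
      nlinarith
    have hcone1 : Xj j ^ κ₀ ≤ (2 : ℝ) ^ j := by
      calc Xj j ^ κ₀ ≤ A ^ κ₀ := Real.rpow_le_rpow hXj0 hXjA (by linarith)
        _ = (2 : ℝ) ^ (((j + 1 : ℕ) : ℝ) / κ * κ₀) := by rw [hA, ← Real.rpow_mul (by norm_num)]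
        _ ≤ (2 : ℝ) ^ ((j : ℕ) : ℝ) := Real.rpow_le_rpow_of_exponent_le (by norm_num) hexp
        _ = (2 : ℝ) ^ j := Real.rpow_natCast 2 j
    have hcone2 : (2 : ℝ) ^ j ≤ Xj j ^ σ := by
      rcases min_cases X A with ⟨hmin, -⟩ | ⟨hmin, -⟩
      · simp only [hXj] at hmin ⊢
        rw [hmin]; exact h2jσ
      · simp only [hXj] at hmin ⊢
        rw [hmin]
        calc (2 : ℝ) ^ j ≤ 2 * (2 : ℝ) ^ j := by linarith [h2j1]
          _ = A ^ κ := hAκ.symm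
          _ ≤ A ^ σ := Real.rpow_le_rpow_of_exponent_le hA1 (by linarith)
    have hb := hC (Xj j) ((2 : ℝ) ^ j) hXj1 h2j1 hcone1 hcone2
    -- `(X_j 2^j)^{ε'} ≤ X^{ε/2}`
    have hloss : (Xj j * (2 : ℝ) ^ j) ^ (ε / (2 * (σ + 1))) ≤ X ^ (ε / 2) := by
      calc (Xj j * (2 : ℝ) ^ j) ^ (ε / (2 * (σ + 1))) ≤ (X * X ^ σ) ^ (ε / (2 * (σ + 1))) :=
            Real.rpow_le_rpow (by positivity) (mul_le_mul hXjX h2jσ (by positivity) hX0.le) hε'.le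
        _ = X ^ (ε / 2) := by
            rw [← Real.rpow_one_add' hX0.le (by positivity), ← Real.rpow_mul hX0.le]
            congr 1
            field_simp
            ring
    -- main term
    have hmain : Xj j * ((2 : ℝ) ^ j) ^ (-(1 / 6 : ℝ)) + 1 ≤ 3 * X ^ (1 - κ / 6) := by
      have := shell_main_le hκ0 hκ6.le hX j
      linarith
    have hnn : 0 ≤ (Xj j * (2 : ℝ) ^ j) ^ (ε / (2 * (σ + 1))) * (Xj j * ((2 : ℝ) ^ j) ^ (-(1 / 6 : ℝ)) + 1) :=
      by positivity
    calc ((cuspShell (Xj j) ((2 : ℝ) ^ j)).ncard : ℝ)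
        ≤ C * (Xj j * (2 : ℝ) ^ j) ^ (ε / (2 * (σ + 1))) * (Xj j * ((2 : ℝ) ^ j) ^ (-(1 / 6 : ℝ)) + 1) := hb
      _ ≤ C₀ * ((Xj j * (2 : ℝ) ^ j) ^ (ε / (2 * (σ + 1))) * (Xj j * ((2 : ℝ) ^ j) ^ (-(1 / 6 : ℝ)) + 1)) := by
          rw [mul_assoc]; exact mul_le_mul_of_nonneg_right (le_max_left _ _) hnn
      _ ≤ C₀ * (X ^ (ε / 2) * (3 * X ^ (1 - κ / 6))) := by
          apply mul_le_mul_of_nonneg_left _ hC₀0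
          exact mul_le_mul hloss hmain (by positivity) (by positivity)
      _ = 3 * C₀ * (X ^ (ε / 2) * X ^ (1 - κ / 6)) := by ring
      _ ≤ (K + 3 * C₀) * (X ^ (ε / 2) * X ^ (1 - κ / 6)) := by gcongr; linarith
      _ = (K + 3 * C₀) * X ^ (ε / 2) * X ^ (1 - κ / 6) := by ring
  -- Step 3: assemble
  have hcount := card_shells_le hσ0 hε hX
  have hKC : 0 ≤ K + 3 * C₀ := by positivity
  have hB0 : 0 ≤ (K + 3 * C₀) * X ^ (ε / 2) * X ^ (1 - κ / 6) := by positivity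
  calc (Set.ncard {W₀ : WeierstrassCurve ℤ | (W₀.baseChange ℚ).IsElliptic ∧
          (∀ v : IsDedekindDomain.HeightOneSpectrum ℤ, (W₀.baseChange ℚ).IsMinimalAt v) ∧
          (W₀.a₁ = 0 ∨ W₀.a₁ = 1) ∧ (W₀.a₃ = 0 ∨ W₀.a₃ = 1) ∧ (W₀.a₂ = -1 ∨ W₀.a₂ = 0 ∨ W₀.a₂ = 1) ∧
          W₀.c₄ ≠ 0 ∧ W₀.c₆ ≠ 0 ∧ (((W₀.baseChange ℚ).conductorNorm ℤ : ℕ) : ℝ) ≤ X ∧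
          (((W₀.baseChange ℚ).conductorNorm ℤ : ℕ) : ℝ) ^ κ ≤ ((max |W₀.Δ| (|W₀.c₄| ^ 3) : ℤ) : ℝ) ∧
          ((max |W₀.Δ| (|W₀.c₄| ^ 3) : ℤ) : ℝ) ≤ (((W₀.baseChange ℚ).conductorNorm ℤ : ℕ) : ℝ) ^ σ} : ℝ)
      ≤ (((↑T : Set (ℤ × ℤ × ℤ)) ×ˢ U).ncard : ℝ) := by exact_mod_cast h1
    _ = 12 * (U.ncard : ℝ) := by rw [h2]; push_cast; ring
    _ ≤ 12 * ∑ j ∈ Finset.range (J + 1), ((cuspShell (Xj j) ((2 : ℝ) ^ j)).ncard : ℝ) := by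
        have : (U.ncard : ℝ) ≤ ∑ j ∈ Finset.range (J + 1), ((cuspShell (Xj j) ((2 : ℝ) ^ j)).ncard : ℝ) := by
          exact_mod_cast h3
        linarith
    _ ≤ 12 * ∑ _j ∈ Finset.range (J + 1), (K + 3 * C₀) * X ^ (ε / 2) * X ^ (1 - κ / 6) := by
        gcongr with j hj
        exact hshell j hj
    _ = 12 * (((J + 1 : ℕ) : ℝ) * ((K + 3 * C₀) * X ^ (ε / 2) * X ^ (1 - κ / 6))) := by
        rw [Finset.sum_const, Finset.card_range, nsmul_eq_mul]
    _ ≤ 12 * (((2 * σ / (ε * Real.log 2) + 1) * X ^ (ε / 2)) * ((K + 3 * C₀) * X ^ (ε / 2) * X ^ (1 - κ / 6))) := by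
        gcongr
    _ = 12 * (K + 3 * C₀) * (2 * σ / (ε * Real.log 2) + 1) * (X ^ (ε / 2) * X ^ (ε / 2) * X ^ (1 - κ / 6)) := by
        ring
    _ = 12 * (K + 3 * C₀) * (2 * σ / (ε * Real.log 2) + 1) * X ^ (1 - κ / 6 + ε) := by
        rw [← Real.rpow_add hX0, ← Real.rpow_add hX0]
        congr 2
        ring

/-! ## 3. The core implies the summit -/

/-- **`abc_of_coreLaw`**: the canonical core implies the summit `ABC` (`sharpModerateLaw_of_coreLaw` and the landed
`abc_of_sharpModerateLaw`, `…ModerateWindowCountCalibration.lean`: route TwistAmplification with every other item closed). -/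
theorem abc_of_coreLaw : CoreLaw → _root_.ABC :=
  fun h => Summit.ABC.ABC.Theorems.abc_of_sharpModerateLaw (sharpModerateLaw_of_coreLaw h)

end Summit.ABC.ABC.Theorems.SharpModerateLaw

end
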